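import Summits.BirchSwinnertonDyer.BirchSwinnertonDyer.Theorems.ResidualThetaTransportAtTwoResidualSignedLambdaLowerCMAtTwoMazurTateValuesRelay
import Literature.NumberTheory.EllipticCurves.GreenbergSelmerCharIdealPrincipalProofs
import HarnessLib

/-!
# The values relay DESCENDS along `range ι ⊆ S'`: q-elimination for the (i)-half (`relay_descends`) — run K-β over `𝒪_{S'}` with the multiplier
# `C u · μt` (`u = 2^a·q ∈ 𝒪_{S'}`), then descend ONE coefficient to `𝒪_{range ι}`; the `K`-rationality of the values constant is a COROLLARY

Route `ResidualThetaTransportAtTwo` (RTT), crux RSL_g `ResidualSignedLambdaLowerCMAtTwo` (stmt-BirchSwinnertonDyer-22608), hold KZ_g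
`KatoZetaCMFormAtTwoSupply` (stmt-BirchSwinnertonDyer-24105). Width seat `prover-bsd-wall-tp2-p2x-w2` g21 (`--supports 22608 --as helper`, closes
nothing). THEOREMS ONLY (no `def`: the sketch's `inclO h` / `inclΛ h` are inlined as `Subring.inclusion (padicCoeffIntegers_mono h)` /
`PowerSeries.map (Subring.inclusion …)`, as its own docstrings prescribe); BSD is NOT proved by any of this; 22608 / 26074 / 24105 stay OPEN / HOLD.
PORT of the kernel-checked sketch `Cruxes/ResidualThetaCountLowerPureAtTwo/Sketch_sidea_k1_g26.lean` §A–§F (stub-ideation k1 g26; STUB-PLAN rev 27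
row 95 / S142 «F-q STAND»: `q : PadicAlgCl 2` stays in child A; the kernel runs the relay over `S′ := range ι ∪ {q}` and descends), on top of the landed
Λ-multiplier relay `…MazurTateValuesRelay` (p715086; the sketch's §0 local copies of `congr_mul_of_isCongrModOmegaO` / `congr_of_dvd_sub` /
`dvd_sub_of_congr_powerSeries` are the landed ones). Critic g27: «(d) NEW RelayDescends port GO». Credit: stub-ideation k1 g26 (every statement).

* §A change of coefficient set `S ⊆ S'` (`padicCoeffIntegers_mono`, `coe_inclO`, `coeff_inclΛ`, `iwasawaOToPowerSeries_inclΛ`, `inclΛ_injective`,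
  `inclΛ_coe_map`, `IsCongrModOmegaO.of_subset`); §B `IsPollackPairK.even_congr_of_subset`; §C `C_mul_mul_eq_mul_of_congruences_gen` (K-β over ANY
  `𝒪_S` and any left family `θ`); §D `exists_natCast_pow_mul_mem_padicCoeffIntegers` (`p^a·q ∈ 𝒪_S`); §E one-coefficient descent
  `exists_eq_C_mul_of_inclΛ_eq`; §F **`relay_descends`** (station (R) with `D := C u₀ · μt`, `u₀ ∈ 𝒪_{range ι}`) and `mem_padicCoeffField_of_natCast_pow_mul_mem`.

References: [Kato2004Asterisque] Thm. 12.5 (1) (p. 221), Thm. 16.6.2 (p. 268); [Pollack2003] Thm. 5.1, 5.6, Prop. 6.18; [Sprung2017] Thm. 1.1, Cor. 4.4;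
[EmertonPollackWeston2006] §3.1.
-/

set_option autoImplicit false
-- D-0017: single-problem summit, so `Summit.BirchSwinnertonDyer.BirchSwinnertonDyer.…` repeats a namespace BY DESIGN.
set_option linter.dupNamespace false

noncomputable section

open scoped Classical Polynomial

namespace Summit.BirchSwinnertonDyer.BirchSwinnertonDyer.Theorems.ThetaTransport.MazurTateValuesRelay

open Polynomial (X)
open Literature.NumberTheory.EllipticCurves Literature.NumberTheory.EllipticCurves.ModularForms CongruenceSubgroup
  Literature.NumberTheory.Automorphic
  Summit.BirchSwinnertonDyer.BirchSwinnertonDyer.Theorems.PollackPairK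

variable {p : ℕ} [hp : Fact p.Prime]

/-! ## §0 LOCAL COPIES of the landed relay's §1 (`Theorems/…ResidualSignedLambdaLowerCMAtTwoMazurTateValuesRelay.lean`, ns
`…Theorems.ThetaTransport.MazurTateValuesRelay`, w2 g21) — verbatim; present ONLY because the farm snapshot used by `lean check` had not yet built that
module when this sketch was checked (remote:stale:1249:unbuilt). A Theorems port imports the landed module and deletes this section. -/

/-! ## §A Change of coefficient set `S ⊆ S'` -/

section BaseChange

variable {S S' : Set (PadicAlgCl p)}

/-- `𝒪_S ⊆ 𝒪_{S'}` for `S ⊆ S'`. [cite: EmertonPollackWeston2006, §3.1 (p. 17) (plumbing)] -/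
theorem padicCoeffIntegers_mono (h : S ⊆ S') : padicCoeffIntegers S ≤ padicCoeffIntegers S' :=
  fun _ hx ↦ ⟨IntermediateField.adjoin.mono ℚ_[p] S S' h hx.1, hx.2⟩

/-- The inclusion `𝒪_S ↪ 𝒪_{S'}` is the identity on `ℚ̄_p`. [cite: EmertonPollackWeston2006, §3.1 (p. 17) (plumbing)] -/
@[simp] theorem coe_inclO (h : S ⊆ S') (x : padicCoeffIntegers S) :
    (((Subring.inclusion (padicCoeffIntegers_mono h)) x : padicCoeffIntegers S') : PadicAlgCl p) = x :=
  Subring.coe_inclusion (padicCoeffIntegers_mono h) x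

/-- Coefficients of the coefficientwise inclusion `Λ_{𝒪_S} ↪ Λ_{𝒪_{S'}}`. [cite: Sprung2017, Thm. 1.1 (plumbing)] -/
@[simp] theorem coeff_inclΛ (h : S ⊆ S') (L : IwasawaAlgebraO S) (k : ℕ) :
    PowerSeries.coeff k ((PowerSeries.map (Subring.inclusion (padicCoeffIntegers_mono h))) L) = (Subring.inclusion (padicCoeffIntegers_mono h)) (PowerSeries.coeff k L) := by
  rw [PowerSeries.coeff_map]

/-- The inclusion `Λ_{𝒪_S} ↪ Λ_{𝒪_{S'}}` on constants. [cite: Sprung2017, Thm. 1.1 (plumbing)] -/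
theorem inclΛ_C (h : S ⊆ S') (c : padicCoeffIntegers S) : (PowerSeries.map (Subring.inclusion (padicCoeffIntegers_mono h))) (PowerSeries.C c) = PowerSeries.C ((Subring.inclusion (padicCoeffIntegers_mono h)) c) := by
  rw [PowerSeries.map_C]

/-- `inclΛ` is invisible in `ℚ̄_p⟦T⟧`. [cite: Sprung2017, Thm. 1.1 (plumbing)] -/
@[simp] theorem iwasawaOToPowerSeries_inclΛ (h : S ⊆ S') (L : IwasawaAlgebraO S) :
    iwasawaOToPowerSeries S' ((PowerSeries.map (Subring.inclusion (padicCoeffIntegers_mono h))) L) = iwasawaOToPowerSeries S L := by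
  ext k
  rw [coeff_iwasawaOToPowerSeries, coeff_iwasawaOToPowerSeries, coeff_inclΛ h, coe_inclO h]

/-- The inclusion `Λ_{𝒪_S} ↪ Λ_{𝒪_{S'}}` is injective. [cite: Sprung2017, Thm. 1.1 (plumbing)] -/
theorem inclΛ_injective (h : S ⊆ S') : Function.Injective ((PowerSeries.map (Subring.inclusion (padicCoeffIntegers_mono h)))) := fun L₁ L₂ e ↦ by
  apply iwasawaOToPowerSeries_injective S
  rw [← iwasawaOToPowerSeries_inclΛ h, ← iwasawaOToPowerSeries_inclΛ h, e]

/-- `ι_Λ (C c) = C ↑c`. [cite: Sprung2017, Thm. 1.1 (plumbing)] -/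
@[simp] theorem iwasawaOToPowerSeries_C (c : padicCoeffIntegers S) :
    iwasawaOToPowerSeries S (PowerSeries.C c) = PowerSeries.C (c : PadicAlgCl p) := by
  rw [iwasawaOToPowerSeries, PowerSeries.map_C, Subring.coe_subtype]

/-- `inclΛ` fixes (the power series of) integer polynomials — in particular `ω_n`, `±ω_n^±`. [folklore] -/
theorem inclΛ_coe_map (h : S ⊆ S') (P : ℤ[X]) :
    (PowerSeries.map (Subring.inclusion (padicCoeffIntegers_mono h))) ((P.map (Int.castRingHom (padicCoeffIntegers S)) : (padicCoeffIntegers S)[X]) : IwasawaAlgebraO S) =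
      ((P.map (Int.castRingHom (padicCoeffIntegers S')) : (padicCoeffIntegers S')[X]) : IwasawaAlgebraO S') := by
  apply iwasawaOToPowerSeries_injective S'
  rw [iwasawaOToPowerSeries_inclΛ h, iwasawaOToPowerSeries_coe_map, iwasawaOToPowerSeries_coe_map]

/-- **Congruences `mod ω_n` in `Λ_𝒪 ⊗ ℚ` are insensitive to enlarging `𝒪`.** [cite: Sprung2017, Cor. 4.4 (shape)] -/
theorem IsCongrModOmegaO.of_subset (h : S ⊆ S') {n : ℕ} {θ : (PadicAlgCl p)[X]} {L : PowerSeries (PadicAlgCl p)}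
    (hc : IsCongrModOmegaO S n θ L) : IsCongrModOmegaO S' n θ L := by
  obtain ⟨m, q, e⟩ := hc
  exact ⟨m, (PowerSeries.map (Subring.inclusion (padicCoeffIntegers_mono h))) q, by rwa [iwasawaOToPowerSeries_inclΛ h]⟩

end BaseChange

/-! ## §B The even Mazur–Tate congruences of an `𝒪`-Pollack pair over any `S' ⊇ range ι` -/

section Pollack

variable {M : ℕ} {g : CuspForm (Gamma0 M) 2} {ι : coeffField g →+* PadicAlgCl p} {Ω : ℂ}

/-- [cite: Pollack2003, Thm. 5.6 and Prop. 6.18 (shape)] -/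
theorem IsPollackPairK.even_congr_of_subset {S' : Set (PadicAlgCl p)} (h : Set.range ι ⊆ S')
    {Lp Lm : IwasawaAlgebraO (Set.range ι)} (hL : IsPollackPairK g ι Ω Lp Lm) (n : ℕ) (hn : Even n) :
    IsCongrModOmegaO S' n ((mazurTateElementK g Ω p n).map ι)
      (((((-1) ^ (n / 2 + 1) * cyclotomicOmegaMinus p n).map (Int.castRingHom (PadicAlgCl p)) :
          (PadicAlgCl p)[X]) : PowerSeries (PadicAlgCl p)) * iwasawaOToPowerSeries S' ((PowerSeries.map (Subring.inclusion (padicCoeffIntegers_mono h))) Lm)) := by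
  rw [iwasawaOToPowerSeries_inclΛ h]
  exact IsCongrModOmegaO.of_subset h (hL.2.2.2 n hn)

end Pollack

/-! ## §C The relay K-β over a GENERIC coefficient set `S` and a generic left family `θ` -/

section Relay

variable {S : Set (PadicAlgCl p)}

/-- **K-β, Λ-multiplier form, generic `S` and `θ`.** If `θ m ≡ (−1)^{m+1}ω⁻_{2m}·L⁻ (mod ω_{2m})` in `Λ_𝒪 ⊗ ℚ` for all `m` (the even half of
a Pollack pair, over ANY `𝒪 = 𝒪_S`), the column congruences `ω_{2m} ∣ Q_m + (−1)^m ω⁻_{2m} E` hold and MTV_Λ `μt·θ m ≡ ν·w·Q_m (mod ω_{2m})`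
holds, then `C ν · w · E = μt · L⁻`. Verbatim port of the landed `C_mul_mul_eq_mul_of_congruences` (`S = range ι`, `θ m = θ_{2m}(g)^ι`).
[cite: Pollack2003, Thm. 5.1 and Prop. 6.18] [cite: Kato2004Asterisque, Thm. 12.5 (1) (p. 221)] -/
theorem C_mul_mul_eq_mul_of_congruences_gen [FiniteDimensional ℚ_[p] (padicCoeffField S)]
    (θ : ℕ → (PadicAlgCl p)[X]) (Lm : IwasawaAlgebraO S)
    (heven : ∀ m : ℕ, IsCongrModOmegaO S (2 * m) (θ m)
      (((((-1) ^ (2 * m / 2 + 1) * cyclotomicOmegaMinus p (2 * m)).map (Int.castRingHom (PadicAlgCl p)) :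
          (PadicAlgCl p)[X]) : PowerSeries (PadicAlgCl p)) * iwasawaOToPowerSeries S Lm))
    (E : IwasawaAlgebraO S) (Q : ℕ → IwasawaAlgebraO S)
    (μt : IwasawaAlgebraO S) (ν : padicCoeffIntegers S) (w : IwasawaAlgebraO S)
    (hcol : ∀ m : ℕ, (((cyclotomicOmega p (2 * m)).map (Int.castRingHom (padicCoeffIntegers S)) :
        (padicCoeffIntegers S)[X]) : IwasawaAlgebraO S) ∣
      Q m + ((((-1) ^ m * cyclotomicOmegaMinus p (2 * m)).map (Int.castRingHom (padicCoeffIntegers S)) :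
        (padicCoeffIntegers S)[X]) : IwasawaAlgebraO S) * E)
    (hMT : ∀ m : ℕ, ∃ (k : ℕ) (q : IwasawaAlgebraO S),
      PowerSeries.C ((p : PadicAlgCl p) ^ k) *
          (iwasawaOToPowerSeries S μt * ((θ m : (PadicAlgCl p)[X]) : PowerSeries (PadicAlgCl p)) -
            iwasawaOToPowerSeries S (PowerSeries.C ν * w * Q m)) =
        (((cyclotomicOmega p (2 * m)).map (Int.castRingHom (PadicAlgCl p)) : (PadicAlgCl p)[X]) : PowerSeries (PadicAlgCl p)) *
          iwasawaOToPowerSeries S q) :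
    PowerSeries.C ν * w * E = μt * Lm := by
  haveI : IsDiscreteValuationRing (padicCoeffIntegers S) := isDiscreteValuationRing_padicCoeffIntegers
  haveI : CharP (IsLocalRing.ResidueField (padicCoeffIntegers S)) p := charP_residueField_padicCoeffIntegers
  have hsign : ∀ n : ℕ, ((-1 : ℤ[X]) ^ (n / 2 + 1)) = 1 ∨ ((-1 : ℤ[X]) ^ (n / 2 + 1)) = -1 :=
    fun n ↦ neg_one_pow_eq_or ℤ[X] (n / 2 + 1)
  -- (c) multiplied by `μt`: `μt θ m ≡ ((-1)^{m+1} ω⁻_{2m}) · (μt L⁻)`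
  have h₁ : ∀ m : ℕ, ∃ (k : ℕ) (q : IwasawaAlgebraO S),
      PowerSeries.C ((p : PadicAlgCl p) ^ k) *
          (iwasawaOToPowerSeries S μt * ((θ m : (PadicAlgCl p)[X]) : PowerSeries (PadicAlgCl p)) -
            (((((-1) ^ (2 * m / 2 + 1) * cyclotomicOmegaMinus p (2 * m)).map (Int.castRingHom (PadicAlgCl p)) :
              (PadicAlgCl p)[X]) : PowerSeries (PadicAlgCl p)) * iwasawaOToPowerSeries S (μt * Lm))) =
        (((cyclotomicOmega p (2 * m)).map (Int.castRingHom (PadicAlgCl p)) : (PadicAlgCl p)[X]) : PowerSeries (PadicAlgCl p)) *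
          iwasawaOToPowerSeries S q :=
    fun m ↦ congr_mul_of_isCongrModOmegaO (heven m) μt
  -- (a)+(b): `μt θ m ≡ ν w Q_m ≡ ((-1)^{m+1} ω⁻_{2m}) · (ν w E)` — the second step is an INTEGRAL congruence
  have h₂ : ∀ m : ℕ, ∃ (k : ℕ) (q : IwasawaAlgebraO S),
      PowerSeries.C ((p : PadicAlgCl p) ^ k) *
          (iwasawaOToPowerSeries S μt * ((θ m : (PadicAlgCl p)[X]) : PowerSeries (PadicAlgCl p)) -
            (((((-1) ^ (2 * m / 2 + 1) * cyclotomicOmegaMinus p (2 * m)).map (Int.castRingHom (PadicAlgCl p)) :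
              (PadicAlgCl p)[X]) : PowerSeries (PadicAlgCl p)) * iwasawaOToPowerSeries S (PowerSeries.C ν * w * E))) =
        (((cyclotomicOmega p (2 * m)).map (Int.castRingHom (PadicAlgCl p)) : (PadicAlgCl p)[X]) : PowerSeries (PadicAlgCl p)) *
          iwasawaOToPowerSeries S q := by
    intro m
    have hc : ((-1 : ℤ[X]) ^ (2 * m / 2 + 1) * cyclotomicOmegaMinus p (2 * m)) =
        -((-1) ^ m * cyclotomicOmegaMinus p (2 * m)) := by
      rw [Nat.mul_div_cancel_left m two_pos, pow_succ]; ring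
    have key := congr_of_dvd_sub (hMT m)
      (L₂ := ((((-1) ^ (2 * m / 2 + 1) * cyclotomicOmegaMinus p (2 * m)).map
          (Int.castRingHom (padicCoeffIntegers S)) : (padicCoeffIntegers S)[X]) :
            IwasawaAlgebraO S) * (PowerSeries.C ν * w * E))
      (by
        obtain ⟨r, hr⟩ := hcol m
        refine ⟨PowerSeries.C ν * w * r, ?_⟩
        rw [hc, Polynomial.map_neg, Polynomial.coe_neg]
        linear_combination (PowerSeries.C ν * w) * hr)
    simpa only [map_mul, iwasawaOToPowerSeries_coe_map] using key
  -- rigidity: `T ω⁺_{2m} ∣ ν w E − μt L⁻` for all `m`, and `⋂ (T ω⁺_{2m}) = 0`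
  rw [← sub_eq_zero]
  refine eq_zero_of_forall_dvd_of_map_eq_X_pow (O := padicCoeffIntegers S)
    (fun m : ℕ ↦ (((X * cyclotomicOmegaPlus p (2 * m)).map (Int.castRingHom (padicCoeffIntegers S)) :
      (padicCoeffIntegers S)[X]) : IwasawaAlgebraO S))
    (fun m ↦ (X * cyclotomicOmegaPlus p (2 * m)).natDegree)
    (fun m ↦ map_residue_coe_eq_X_pow p (Polynomial.monic_X.mul (monic_cyclotomicOmegaPlus p _))
      (X_mul_cyclotomicOmegaPlus_dvd p _))
    (fun k ↦ ⟨k, ?_⟩) (fun m ↦ ?_)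
  · rw [Polynomial.monic_X.natDegree_mul (monic_cyclotomicOmegaPlus p _), Polynomial.natDegree_X]
    have := le_natDegree_cyclotomicOmegaPlus p k
    omega
  · exact dvd_sub_of_congr_powerSeries (S := S) (hsign (2 * m)) (Polynomial.monic_X.mul (monic_cyclotomicOmegaPlus p _))
      (monic_cyclotomicOmegaMinus p _) (X_mul_cyclotomicOmegaPlus_mul_cyclotomicOmegaMinus p (2 * m)).symm
      (h₁ m) (h₂ m)

end Relay

/-! ## §D The rescaled values constant `u := p^a · q` is integral in `ℚ_p(S ∪ {q})` -/

section Constant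

variable {S : Set (PadicAlgCl p)}

/-- `q ∈ ℚ_p(S ∪ {q})`. [cite: EmertonPollackWeston2006, §3.1 (p. 17) (plumbing)] -/
theorem mem_padicCoeffField_union_singleton (S : Set (PadicAlgCl p)) (q : PadicAlgCl p) :
    q ∈ padicCoeffField (S ∪ {q}) :=
  IntermediateField.subset_adjoin ℚ_[p] _ (Set.mem_union_right S rfl)

/-- **`p^a · q ∈ 𝒪_S` for `q ∈ ℚ_p(S)` and `a` large** (`𝒪_S[1/p] = ℚ_p(S)`). [cite: EmertonPollackWeston2006, §3.1 (p. 17)] -/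
theorem exists_natCast_pow_mul_mem_padicCoeffIntegers {q : PadicAlgCl p} (hq : q ∈ padicCoeffField S) :
    ∃ a : ℕ, (p : PadicAlgCl p) ^ a * q ∈ padicCoeffIntegers S := by
  have hp1 : (1 : ℝ) < p := by exact_mod_cast hp.out.one_lt
  have hp0 : (0 : ℝ) < p := lt_trans zero_lt_one hp1
  obtain ⟨a, ha⟩ := pow_unbounded_of_one_lt ‖q‖ hp1
  refine ⟨a, mul_mem (pow_mem (natCast_mem (padicCoeffField S) p) a) hq, ?_⟩
  have hnp : ‖(p : PadicAlgCl p)‖ = (p : ℝ)⁻¹ := by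
    rw [← map_natCast (algebraMap ℚ_[p] (PadicAlgCl p)) p]
    change ‖((p : ℚ_[p]) : PadicAlgCl p)‖ = _
    rw [PadicAlgCl.norm_extends, Padic.norm_p]
  rw [norm_mul, norm_pow, hnp, inv_pow, inv_mul_le_iff₀ (pow_pos hp0 a), mul_one]
  exact ha.le

end Constant

/-! ## §E One-coefficient descent `Λ_{𝒪'} → Λ_𝒪` -/

section Descent

variable {S S' : Set (PadicAlgCl p)}

/-- **One-coefficient descent.** If `F, G ∈ Λ_{𝒪_S}`, `G ≠ 0`, and `F = C u · G` holds in `Λ_{𝒪_{S'}}` (`S ⊆ S'`, `u ∈ 𝒪_{S'}`), then `u ∈ 𝒪_S`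
(compare ONE coefficient where `G_k ≠ 0`: `u = F_k / G_k ∈ ℚ_p(S)`, `‖u‖ ≤ 1`) and `F = C u · G` already in `Λ_{𝒪_S}`. [folklore] -/
theorem exists_eq_C_mul_of_inclΛ_eq (h : S ⊆ S') {F G : IwasawaAlgebraO S} {u : padicCoeffIntegers S'} (hG : G ≠ 0)
    (e : (PowerSeries.map (Subring.inclusion (padicCoeffIntegers_mono h))) F = PowerSeries.C u * (PowerSeries.map (Subring.inclusion (padicCoeffIntegers_mono h))) G) :
    ∃ u₀ : padicCoeffIntegers S, (Subring.inclusion (padicCoeffIntegers_mono h)) u₀ = u ∧ F = PowerSeries.C u₀ * G := by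
  obtain ⟨k, hk⟩ : ∃ k, PowerSeries.coeff k G ≠ 0 := by
    by_contra hcon
    exact hG (PowerSeries.ext fun k ↦ by rw [map_zero]; exact not_not.1 fun h' ↦ hcon ⟨k, h'⟩)
  have e' : iwasawaOToPowerSeries S F = PowerSeries.C (u : PadicAlgCl p) * iwasawaOToPowerSeries S G := by
    have e₁ := congr_arg (iwasawaOToPowerSeries S') e
    rwa [map_mul, iwasawaOToPowerSeries_inclΛ h, iwasawaOToPowerSeries_inclΛ h, iwasawaOToPowerSeries_C] at e₁
  have ek : ((PowerSeries.coeff k F : padicCoeffIntegers S) : PadicAlgCl p) =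
      (u : PadicAlgCl p) * ((PowerSeries.coeff k G : padicCoeffIntegers S) : PadicAlgCl p) := by
    have e₂ := congr_arg (PowerSeries.coeff k) e'
    rwa [coeff_iwasawaOToPowerSeries, PowerSeries.coeff_C_mul, coeff_iwasawaOToPowerSeries] at e₂
  have hGk : ((PowerSeries.coeff k G : padicCoeffIntegers S) : PadicAlgCl p) ≠ 0 := by
    rw [Ne, ZeroMemClass.coe_eq_zero]
    exact hk
  have hu : (u : PadicAlgCl p) ∈ padicCoeffIntegers S := by
    refine ⟨?_, u.2.2⟩
    have : (u : PadicAlgCl p) = ((PowerSeries.coeff k F : padicCoeffIntegers S) : PadicAlgCl p) *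
        (((PowerSeries.coeff k G : padicCoeffIntegers S) : PadicAlgCl p))⁻¹ := by
      rw [ek, mul_inv_cancel_right₀ hGk]
    rw [this]
    exact mul_mem (PowerSeries.coeff k F).2.1 (inv_mem (PowerSeries.coeff k G).2.1)
  refine ⟨⟨u, hu⟩, Subtype.ext (coe_inclO h ⟨(u : PadicAlgCl p), hu⟩), ?_⟩
  apply iwasawaOToPowerSeries_injective S
  rw [e', map_mul, iwasawaOToPowerSeries_C]

end Descent

/-! ## §F The packaged q-elimination: relay over `S' ⊇ range ι` with multiplier `C u · μt`, then descend -/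

section Package

variable {M : ℕ} {g : CuspForm (Gamma0 M) 2} {ι : coeffField g →+* PadicAlgCl p} {Ω : ℂ}

/-- **q-elimination (road R-q1 of the card).** `(L⁺, L⁻)` an `𝒪`-Pollack pair over `𝒪 = 𝒪_{range ι}`; `E, Q_m, μt ≠ 0, ν, w` over `𝒪`
with the column congruences; `u ∈ 𝒪_{S'}` for some finite-dimensional `S' ⊇ range ι` (e.g. `u = 2^a·q`, `S' = range ι ∪ {q}`); MTV_Λ over
`S'` with the multiplier `C u · μt`: `(C u·μt)·θ_{2m}(g)^ι ≡ ν·w·Q_m (mod ω_{2m})`. THEN `u ∈ 𝒪` and `C ν · w · E = C u · μt · L⁻` over `𝒪` —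
station (R) of the (i)-half interior with `D := C u · μt`, and the K-rationality of the values constant as a COROLLARY, not an input.
[cite: Kato2004Asterisque, Thm. 12.5 (1) (p. 221) and Thm. 16.6.2 (p. 268)] [cite: Pollack2003, Prop. 6.18] -/
theorem relay_descends {S' : Set (PadicAlgCl p)} [FiniteDimensional ℚ_[p] (padicCoeffField S')]
    (h : Set.range ι ⊆ S') {Lp Lm : IwasawaAlgebraO (Set.range ι)} (hL : IsPollackPairK g ι Ω Lp Lm)
    (E : IwasawaAlgebraO (Set.range ι)) (Q : ℕ → IwasawaAlgebraO (Set.range ι))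
    (μt : IwasawaAlgebraO (Set.range ι)) (hμ : μt ≠ 0) (ν : padicCoeffIntegers (Set.range ι)) (w : IwasawaAlgebraO (Set.range ι))
    (u : padicCoeffIntegers S')
    (hcol : ∀ m : ℕ, (((cyclotomicOmega p (2 * m)).map (Int.castRingHom (padicCoeffIntegers (Set.range ι))) :
        (padicCoeffIntegers (Set.range ι))[X]) : IwasawaAlgebraO (Set.range ι)) ∣
      Q m + ((((-1) ^ m * cyclotomicOmegaMinus p (2 * m)).map (Int.castRingHom (padicCoeffIntegers (Set.range ι))) :
        (padicCoeffIntegers (Set.range ι))[X]) : IwasawaAlgebraO (Set.range ι)) * E)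
    (hMT : ∀ m : ℕ, ∃ (k : ℕ) (q' : IwasawaAlgebraO S'),
      PowerSeries.C ((p : PadicAlgCl p) ^ k) *
          (iwasawaOToPowerSeries S' (PowerSeries.C u * (PowerSeries.map (Subring.inclusion (padicCoeffIntegers_mono h))) μt) *
              (((mazurTateElementK g Ω p (2 * m)).map ι : (PadicAlgCl p)[X]) : PowerSeries (PadicAlgCl p)) -
            iwasawaOToPowerSeries S' ((PowerSeries.map (Subring.inclusion (padicCoeffIntegers_mono h))) (PowerSeries.C ν * w * Q m))) =
        (((cyclotomicOmega p (2 * m)).map (Int.castRingHom (PadicAlgCl p)) : (PadicAlgCl p)[X]) : PowerSeries (PadicAlgCl p)) *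
          iwasawaOToPowerSeries S' q') :
    ∃ u₀ : padicCoeffIntegers (Set.range ι), (Subring.inclusion (padicCoeffIntegers_mono h)) u₀ = u ∧ PowerSeries.C ν * w * E = PowerSeries.C u₀ * μt * Lm := by
  -- the relay over `S'`
  have hcol' : ∀ m : ℕ, (((cyclotomicOmega p (2 * m)).map (Int.castRingHom (padicCoeffIntegers S')) :
        (padicCoeffIntegers S')[X]) : IwasawaAlgebraO S') ∣
      (PowerSeries.map (Subring.inclusion (padicCoeffIntegers_mono h))) (Q m) + ((((-1) ^ m * cyclotomicOmegaMinus p (2 * m)).map (Int.castRingHom (padicCoeffIntegers S')) :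
        (padicCoeffIntegers S')[X]) : IwasawaAlgebraO S') * (PowerSeries.map (Subring.inclusion (padicCoeffIntegers_mono h))) E := by
    intro m
    have := map_dvd ((PowerSeries.map (Subring.inclusion (padicCoeffIntegers_mono h)))) (hcol m)
    rwa [map_add, map_mul, inclΛ_coe_map h, inclΛ_coe_map h] at this
  have hMT' : ∀ m : ℕ, ∃ (k : ℕ) (q' : IwasawaAlgebraO S'),
      PowerSeries.C ((p : PadicAlgCl p) ^ k) *
          (iwasawaOToPowerSeries S' (PowerSeries.C u * (PowerSeries.map (Subring.inclusion (padicCoeffIntegers_mono h))) μt) *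
              (((mazurTateElementK g Ω p (2 * m)).map ι : (PadicAlgCl p)[X]) : PowerSeries (PadicAlgCl p)) -
            iwasawaOToPowerSeries S' (PowerSeries.C ((Subring.inclusion (padicCoeffIntegers_mono h)) ν) * (PowerSeries.map (Subring.inclusion (padicCoeffIntegers_mono h))) w * (PowerSeries.map (Subring.inclusion (padicCoeffIntegers_mono h))) (Q m))) =
        (((cyclotomicOmega p (2 * m)).map (Int.castRingHom (PadicAlgCl p)) : (PadicAlgCl p)[X]) : PowerSeries (PadicAlgCl p)) *
          iwasawaOToPowerSeries S' q' := by
    intro m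
    obtain ⟨k, q', e⟩ := hMT m
    refine ⟨k, q', ?_⟩
    have hsplit : (PowerSeries.map (Subring.inclusion (padicCoeffIntegers_mono h))) (PowerSeries.C ν * w * Q m) = PowerSeries.C ((Subring.inclusion (padicCoeffIntegers_mono h)) ν) * (PowerSeries.map (Subring.inclusion (padicCoeffIntegers_mono h))) w * (PowerSeries.map (Subring.inclusion (padicCoeffIntegers_mono h))) (Q m) := by
      rw [map_mul, map_mul, inclΛ_C h]
    rwa [hsplit] at e
  have key := C_mul_mul_eq_mul_of_congruences_gen (S := S') (fun m ↦ (mazurTateElementK g Ω p (2 * m)).map ι) ((PowerSeries.map (Subring.inclusion (padicCoeffIntegers_mono h))) Lm)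
    (fun m ↦ IsPollackPairK.even_congr_of_subset h hL (2 * m) ⟨m, two_mul m⟩) ((PowerSeries.map (Subring.inclusion (padicCoeffIntegers_mono h))) E) (fun m ↦ (PowerSeries.map (Subring.inclusion (padicCoeffIntegers_mono h))) (Q m))
    (PowerSeries.C u * (PowerSeries.map (Subring.inclusion (padicCoeffIntegers_mono h))) μt) ((Subring.inclusion (padicCoeffIntegers_mono h)) ν) ((PowerSeries.map (Subring.inclusion (padicCoeffIntegers_mono h))) w) hcol' hMT'
  -- descend by one coefficient of `μt · L⁻ ≠ 0`
  have hG : μt * Lm ≠ 0 := mul_ne_zero hμ hL.2.1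
  have e : (PowerSeries.map (Subring.inclusion (padicCoeffIntegers_mono h))) (PowerSeries.C ν * w * E) = PowerSeries.C u * (PowerSeries.map (Subring.inclusion (padicCoeffIntegers_mono h))) (μt * Lm) := by
    have hsplit : (PowerSeries.map (Subring.inclusion (padicCoeffIntegers_mono h))) (PowerSeries.C ν * w * E) = PowerSeries.C ((Subring.inclusion (padicCoeffIntegers_mono h)) ν) * (PowerSeries.map (Subring.inclusion (padicCoeffIntegers_mono h))) w * (PowerSeries.map (Subring.inclusion (padicCoeffIntegers_mono h))) E := by
      rw [map_mul, map_mul, inclΛ_C h]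
    rw [hsplit, key, map_mul, mul_assoc]
  obtain ⟨u₀, hu₀, hF⟩ := exists_eq_C_mul_of_inclΛ_eq h hG e
  exact ⟨u₀, hu₀, by rw [hF, mul_assoc]⟩

/-- **Corollary: the values constant is `K`-rational up to the rescaling** — `u = 2^a q ∈ 𝒪_{range ι}`, so `q ∈ K = ℚ_p(range ι)`.
[cite: Kato2004Asterisque, Thm. 12.5 (1) (p. 221) (`z_γ^{(p)} ∈ H¹(ℤ[1/p], T ⊗ Λ) ⊗ Q(Λ)` with `O_λ`-coefficients)] -/
theorem mem_padicCoeffField_of_natCast_pow_mul_mem {S : Set (PadicAlgCl p)} {q : PadicAlgCl p} {a : ℕ}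
    (hu : (p : PadicAlgCl p) ^ a * q ∈ padicCoeffIntegers S) : q ∈ padicCoeffField S := by
  have hp0 : ((p : PadicAlgCl p) ^ a) ≠ 0 := pow_ne_zero a (by exact_mod_cast hp.out.ne_zero)
  have : q = ((p : PadicAlgCl p) ^ a)⁻¹ * ((p : PadicAlgCl p) ^ a * q) := by
    rw [inv_mul_cancel_left₀ hp0]
  rw [this]
  exact mul_mem (inv_mem (pow_mem (natCast_mem (padicCoeffField S) p) a)) hu.1

end Package

end Summit.BirchSwinnertonDyer.BirchSwinnertonDyer.Theorems.ThetaTransport.MazurTateValuesRelay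

end
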